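import Summits.QuantumFields.BalabanUV.Beta.EriceRemainderEnclosureHistoryAutonomyComparisonDualConcaveRow

/-!
# EriceRemainderEnclosureHistoryAutonomyComparisonDualDiminishingShares — (E137a) **NON-SEPARABLE MEMORY WITH DIMINISHING RETURNS: the staircase chord slopes, their
# share budget, «Φ₀√ℓ isotone» and the one-age deficit.**  The comparison theorems (E135b) `le_of_isotone_excess_affine` (affine memory) and (E136c)
# `le_of_isotone_excess_concave` (SEPARABLE concave memory `β₀ + Σ_k f_k(u_k)`) read the base memory age by age.  The successor question of `HOME/b2b-balaban-beta-d4-p2/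
# HANDOFF.gen104.md` (B′) was the NON-SEPARABLE isotone memory, expected to need a two-sided per-age modulus `m_k ≤ ∂_k B ≤ M_k` with a cost `M_k∕m_k`.  IT DOES NOT:
# the right class is DIMINISHING RETURNS.  A memory `B` of finite range `K` on the CLOSED box `[0,γ]^ℕ` is called here (hypotheses, not a definition) ISOTONE
# (`hmonoC`), with DIMINISHING RETURNS (`hDR`: the increment of `B` in ONE coordinate over a FIXED interval `[a,c]` is antitone in the configuration — continuous
# submodularity, «DR-submodular» in the optimisation literature) and COORDINATEWISE CONCAVE (`hconc`: chord slopes in one coordinate non-increasing in both endpoints,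
# endpoint `0` allowed); `B(0) ≥ 0`.  Examples: every separable concave memory of (E136); `β₀ + Σ_i g_i(Σ_k c_{ik} u_k)` with `g_i` concave non-decreasing and `c ≥ 0`
# (NOT separable); sums and non-negative mixtures of these.  Along the STAIRCASE `P^k = (x_0, …, x_{k−1}, x_{k+1}, x_{k+2}, …)` from the shift `x_{1+·}` to `x` of a
# decreasing box configuration, the chord slopes `λ_k = [B(P^{k+1}) − B(P^k)]∕(x_k − x_{k+1})` play the part of (E136)'s per-age chord slopes, and EVERY per-age
# inequality of (E133)–(E136) survives with them: §0 staircase algebra (`stair_succ`, `stair_eq_update`, `stair_zero`, closed-box bookkeeping); §1 **`stair_budget`** —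
# `λ_k ≥ 0`, `Σ_k λ_k x_k ≤ B(x) − B(0)`, `Σ_k λ_k x_{k+1} ≤ B(x_{1+·}) − B(0)` (chord from `0` in coordinate `k`, then diminishing returns down to the truncation
# `(x_0..x_{k−1}, 0, …)`, whose increments telescope) — this replaces `λ_k x_k ≤ f_k(x_k)`; §2 **`dr_ratio_le`** ∕ **`dr_speed_ratio_le`** — «Φ₀√ℓ isotone»:
# `p′·B(tail_1 S p) ≤ p·B(tail_1 S p′)` for pins `p′ ≤ p` (staircase from the lower tail to the upper one; replaces `f_k(c)·a ≤ f_k(a)·c`); §3 **`dr_deficit_le`** — the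
# one-age deficit `Δ⁰_k − Δ′_k ≤ x_k³Φ⁰_k·w_k²δ_k` ((E133) `deficit_le_gap` with §2).  Sequels: (E137b) the dual row inequality, (E137c) the gauge step, (E137d) the deep step,
# the induction and the comparison theorem `le_of_isotone_excess_dr`.

Cell `pub-balaban`, β-function sub-cell, BINDER row D4 «RemainderConst leaves for Bałaban's split» (`HOME/BINDER-OWNERS.md`; owner lineage `b2b-balaban-beta-an4`;
this file by co-owner #2 lineage `b2b-balaban-beta-d4-p2`, generation 105), β-FLOW TEAM duty (1), FREEZE (0) honoured (def-free; imports (E136a) `…ComparisonDualConcaveRow`;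
uses (E133) `deficit_le_gap`, (E132) `scale_ratio_le`, (E48a) `family_mem` ∕ `family_tail_eq` ∕ `le_of_pin_le` BY NAME; nothing restated).

HONEST FRAMING (page 1, verbatim and binding).  *"Discharging BetaPertH makes Bałaban's UV stability UNCONDITIONAL — a real constructive-QFT result; it is
NOT the continuum limit and NOT the Clay problem."*  THIS FILE DISCHARGES NOTHING OF THE KIND.  Elementary real analysis about ABSTRACT functionals on a box
]0,γ]^ℕ — hypotheses of a census, not facts; the form, signs, ages, moments and convexity of Bałaban's (1.22) limit functional are NOT PRINTED ([I] p. 298; GAPS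
G-t4-U2-1∕-2) and NOT asserted.  Row D4 class UNCHANGED (critical-path width 0; instance 0∕1; D4 DISCHARGE NO DATE).  NOT CLAIMED here: the comparison theorem (the
sequels); anything printed — NOT B12 Thm 2, NOT BetaPertH, NOT continuum, NOT Clay.

WHAT IS PROVED ([folklore]; 0 `def`, 0 sorry).  §0 `stair_succ`, `stair_eq_update`, `stair_zero`, `cbox_stair`, `cbox_of_seqBox`, `cbox_update`.  §1 **`stair_budget`**.
§2 **`dr_ratio_le`**, **`dr_speed_ratio_le`**.  §3 **`dr_deficit_le`**.
-/

noncomputable section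
open Finset Set

namespace Summit.QuantumFields.BalabanUV.Beta.EriceRemainderEnclosureHistoryAutonomyComparisonDualDiminishingShares

open Literature.MathematicalPhysics.QuantumFieldTheory.Balaban1983to89
open Literature.MathematicalPhysics.QuantumFieldTheory.Balaban1983to89.T4BetaStationary
open Literature.MathematicalPhysics.QuantumFieldTheory.Balaban1983to89.T4BetaFlowWellPosed
open Summit.QuantumFields.BalabanUV.Beta.EriceRemainderEnclosureHistoryAutonomyOrder
  (family_zero family_mem family_tail_eq family_succ_eq le_of_pin_le strictAnti_of_memFlow)
open Summit.QuantumFields.BalabanUV.Beta.EriceRemainderEnclosureHistoryAutonomyComparisonDualOrbit (scale_ratio_le)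
open Summit.QuantumFields.BalabanUV.Beta.EriceRemainderEnclosureHistoryAutonomyComparisonDualRow (deficit_le_gap)

variable {B : (ℕ → ℝ) → ℝ} {M γ b : ℝ} {K : ℕ} {S : ℝ → ℕ → ℝ} {h' : ℕ → ℝ}

/-! ## §0 Staircases between two configurations -/

/-- STAIRCASE STEP: taking one more coordinate from `α` is the coordinate update `k ↦ α k`. [folklore] -/
theorem stair_succ (α β : ℕ → ℝ) (k : ℕ) :
    (fun j => if j < k + 1 then α j else β j) = Function.update (fun j => if j < k then α j else β j) k (α k) := by
  funext j
  rcases eq_or_ne j k with rfl | hjk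
  · simp
  · rw [Function.update_of_ne hjk]
    by_cases hj : j < k
    · have hj' : j < k + 1 := by omega
      simp [hj, hj']
    · have hj' : ¬ j < k + 1 := by omega
      simp [hj, hj']

/-- The staircase before the step is the update of itself with the OLD value `β k`. [folklore] -/
theorem stair_eq_update (α β : ℕ → ℝ) (k : ℕ) :
    (fun j => if j < k then α j else β j) = Function.update (fun j => if j < k then α j else β j) k (β k) := by
  funext j
  rcases eq_or_ne j k with rfl | hjk
  · simp
  · rw [Function.update_of_ne hjk]

/-- The empty staircase is the old configuration. [folklore] -/
theorem stair_zero (α β : ℕ → ℝ) : (fun j => if j < 0 then α j else β j) = β := by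
  funext j; simp

/-- A staircase of two configurations of the closed box lies in the closed box. [folklore] -/
theorem cbox_stair {α β : ℕ → ℝ} (hα : ∀ j, 0 ≤ α j ∧ α j ≤ γ) (hβ : ∀ j, 0 ≤ β j ∧ β j ≤ γ) (k : ℕ) :
    ∀ j, 0 ≤ (fun j => if j < k then α j else β j) j ∧ (fun j => if j < k then α j else β j) j ≤ γ := by
  intro j
  by_cases hj : j < k
  · simp only [hj, ↓reduceIte]; exact hα j
  · simp only [hj, ↓reduceIte]; exact hβ j

/-- A box configuration lies in the closed box. [folklore] -/
theorem cbox_of_seqBox {u : ℕ → ℝ} (hu : SeqBox γ u) : ∀ j, 0 ≤ u j ∧ u j ≤ γ := fun j => ⟨(hu j).1.le, (hu j).2⟩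

/-- A coordinate update inside the closed box stays in the closed box. [folklore] -/
theorem cbox_update {u : ℕ → ℝ} (hu : ∀ j, 0 ≤ u j ∧ u j ≤ γ) {c : ℝ} (hc0 : 0 ≤ c) (hcγ : c ≤ γ) (k : ℕ) :
    ∀ j, 0 ≤ Function.update u k c j ∧ Function.update u k c j ≤ γ := by
  intro j
  rcases eq_or_ne j k with rfl | hjk
  · simp [hc0, hcγ]
  · rw [Function.update_of_ne hjk]; exact hu j

/-! ## §1 The staircase chord slopes of a decreasing configuration and their budget -/

/-- **THE STAIRCASE CHORD SLOPES AND THEIR BUDGET.**  Memory `B` of range `K` on the closed box `[0,γ]^ℕ`: ISOTONE, with DIMINISHING RETURNS (the increment in one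
coordinate over a fixed interval is antitone in the configuration) and COORDINATEWISE CONCAVE (chord slopes in one coordinate non-increasing in both endpoints,
endpoint `0` allowed).  For a box configuration `x` with `x_{k+1} < x_k`, the staircase `P^k = (x_0, …, x_{k−1}, x_{k+1}, x_{k+2}, …)` from the shift `P^0 = x_{1+·}`
to `P^K ≡ x` (first `K` coordinates) has chord slopes `λ_k = [B(P^{k+1}) − B(P^k)]∕(x_k − x_{k+1}) ≥ 0`, and the SHARES telescope through the truncations
`(x_0, …, x_{k−1}, 0, …)`: `Σ_{k<K} λ_k x_k ≤ B(x) − B(0)` and `Σ_{k<K} λ_k x_{k+1} ≤ B(x_{1+·}) − B(0)` (chord from `0` in coordinate `k`, then diminishing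
returns down to the truncation).  For separable memory `β₀ + Σ f_k(u_k)` these are `λ_k x_k ≤ f_k(x_k)`, `λ_k x_{k+1} ≤ f_k(x_{k+1})` of (E136a). [folklore] -/
theorem stair_budget (hK : ∀ u v : ℕ → ℝ, (∀ j, j < K → u j = v j) → B u = B v)
    (hmonoC : ∀ u v : ℕ → ℝ, (∀ j, 0 ≤ u j ∧ u j ≤ γ) → (∀ j, 0 ≤ v j ∧ v j ≤ γ) → (∀ j, u j ≤ v j) → B u ≤ B v)
    (hDR : ∀ u v : ℕ → ℝ, (∀ j, 0 ≤ u j ∧ u j ≤ γ) → (∀ j, 0 ≤ v j ∧ v j ≤ γ) → (∀ j, u j ≤ v j) → ∀ (k : ℕ) (a c : ℝ), 0 ≤ a → a ≤ c → c ≤ γ →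
      B (Function.update v k c) - B (Function.update v k a) ≤ B (Function.update u k c) - B (Function.update u k a))
    (hconc : ∀ u : ℕ → ℝ, (∀ j, 0 ≤ u j ∧ u j ≤ γ) → ∀ (k : ℕ) (a c d e : ℝ), 0 ≤ a → a < c → 0 ≤ d → d < e → a ≤ d → c ≤ e → e ≤ γ →
      (B (Function.update u k e) - B (Function.update u k d)) * (c - a) ≤ (B (Function.update u k c) - B (Function.update u k a)) * (e - d))
    {x : ℕ → ℝ} (hx : SeqBox γ x) (hxanti : StrictAnti x) :
    (∀ k, 0 ≤ (B (fun j => if j < k + 1 then x j else x (j + 1)) - B (fun j => if j < k then x j else x (j + 1))) / (x k - x (k + 1)))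
    ∧ ∑ k ∈ range K, (B (fun j => if j < k + 1 then x j else x (j + 1)) - B (fun j => if j < k then x j else x (j + 1))) / (x k - x (k + 1)) * x k
        ≤ B x - B (fun _ => 0)
    ∧ ∑ k ∈ range K, (B (fun j => if j < k + 1 then x j else x (j + 1)) - B (fun j => if j < k then x j else x (j + 1))) / (x k - x (k + 1)) * x (k + 1)
        ≤ B (fun j => x (j + 1)) - B (fun _ => 0) := by
  have hγ : 0 ≤ γ := (hx 0).1.le.trans (hx 0).2
  have hxC : ∀ j, 0 ≤ x j ∧ x j ≤ γ := cbox_of_seqBox hx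
  have hxsC : ∀ j, 0 ≤ x (j + 1) ∧ x (j + 1) ≤ γ := fun j => hxC (j + 1)
  have h0C : ∀ j : ℕ, 0 ≤ (fun _ : ℕ => (0:ℝ)) j ∧ (fun _ : ℕ => (0:ℝ)) j ≤ γ := fun _ => ⟨le_rfl, hγ⟩
  -- the staircases: P (shift → x), T (0 → x), T' (0 → shift)
  set P : ℕ → ℕ → ℝ := fun k j => if j < k then x j else x (j + 1) with hPdef
  set T : ℕ → ℕ → ℝ := fun k j => if j < k then x j else 0 with hTdef
  set T' : ℕ → ℕ → ℝ := fun k j => if j < k then x (j + 1) else 0 with hT'def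
  have hPC : ∀ k, ∀ j, 0 ≤ P k j ∧ P k j ≤ γ := fun k => cbox_stair hxC hxsC k
  have hTC : ∀ k, ∀ j, 0 ≤ T k j ∧ T k j ≤ γ := fun k => cbox_stair hxC h0C k
  have hT'C : ∀ k, ∀ j, 0 ≤ T' k j ∧ T' k j ≤ γ := fun k => cbox_stair hxsC h0C k
  -- the updates
  have hPs : ∀ k, P (k + 1) = Function.update (P k) k (x k) := fun k => stair_succ x (fun j => x (j + 1)) k
  have hPe : ∀ k, P k = Function.update (P k) k (x (k + 1)) := fun k => stair_eq_update x (fun j => x (j + 1)) k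
  have hTs : ∀ k, T (k + 1) = Function.update (T k) k (x k) := fun k => stair_succ x (fun _ => 0) k
  have hTe : ∀ k, T k = Function.update (T k) k 0 := fun k => stair_eq_update x (fun _ => 0) k
  have hT's : ∀ k, T' (k + 1) = Function.update (T' k) k (x (k + 1)) := fun k => stair_succ (fun j => x (j + 1)) (fun _ => 0) k
  have hT'e : ∀ k, T' k = Function.update (T' k) k 0 := fun k => stair_eq_update (fun j => x (j + 1)) (fun _ => 0) k
  -- per coordinate
  have hk : ∀ k, 0 ≤ (B (P (k + 1)) - B (P k)) / (x k - x (k + 1))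
      ∧ (B (P (k + 1)) - B (P k)) / (x k - x (k + 1)) * x k ≤ B (T (k + 1)) - B (T k)
      ∧ (B (P (k + 1)) - B (P k)) / (x k - x (k + 1)) * x (k + 1) ≤ B (T' (k + 1)) - B (T' k) := by
    intro k
    have hxk : 0 < x k := (hx k).1
    have hxk1 : 0 < x (k + 1) := (hx (k + 1)).1
    have hlt : x (k + 1) < x k := hxanti (Nat.lt_succ_self k)
    have hxkγ : x k ≤ γ := (hx k).2
    have hd : 0 < x k - x (k + 1) := by linarith
    -- monotone: the slope is non-negative
    have hnum : 0 ≤ B (P (k + 1)) - B (P k) := by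
      rw [hPs k, hPe k, Function.update_idem]
      refine sub_nonneg.mpr (hmonoC _ _ (cbox_update (hPC k) hxk1.le (hxC (k + 1)).2 k) (cbox_update (hPC k) hxk.le hxkγ k) fun j => ?_)
      rcases eq_or_ne j k with rfl | hjk
      · simp [hlt.le]
      · rw [Function.update_of_ne hjk, Function.update_of_ne hjk]
    refine ⟨div_nonneg hnum hd.le, ?_, ?_⟩
    · -- chord from 0 over [0, x_k] ≥ chord over [x_{k+1}, x_k]; then DR down to the truncation T k ≤ P k
      have hch := hconc (P k) (hPC k) k 0 (x k) (x (k + 1)) (x k) le_rfl hxk hxk1.le hlt hxk1.le le_rfl hxkγ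
      -- (B(P k|x_k) − B(P k|x_{k+1}))·x_k ≤ (B(P k|x_k) − B(P k|0))·(x_k − x_{k+1})
      rw [← hPs k, ← hPe k, sub_zero] at hch
      have hdr := hDR (T k) (P k) (hTC k) (hPC k) (fun j => by
          show (if j < k then x j else (0:ℝ)) ≤ (if j < k then x j else x (j + 1))
          by_cases hj : j < k
          · simp [hj]
          · simp [hj, (hx (j + 1)).1.le]) k 0 (x k) le_rfl hxk.le hxkγ
      rw [← hPs k, ← hTs k, ← hTe k] at hdr
      rw [div_mul_eq_mul_div, div_le_iff₀ hd]
      nlinarith [hdr, hd]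
    · have hch := hconc (P k) (hPC k) k 0 (x (k + 1)) (x (k + 1)) (x k) le_rfl hxk1 hxk1.le hlt hxk1.le hlt.le hxkγ
      rw [← hPs k, ← hPe k, sub_zero] at hch
      have hdr := hDR (T' k) (P k) (hT'C k) (hPC k) (fun j => by
          show (if j < k then x (j + 1) else (0:ℝ)) ≤ (if j < k then x j else x (j + 1))
          by_cases hj : j < k
          · simp [hj, (hxanti.antitone (Nat.le_succ j))]
          · simp [hj, (hx (j + 1)).1.le]) k 0 (x (k + 1)) le_rfl hxk1.le (hxC (k + 1)).2
      rw [← hPe k, ← hT's k, ← hT'e k] at hdr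
      rw [div_mul_eq_mul_div, div_le_iff₀ hd]
      nlinarith [hdr, hd]
  refine ⟨fun k => (hk k).1, ?_, ?_⟩
  · have hs := sum_le_sum fun k (_ : k ∈ range K) => (hk k).2.1
    rw [sum_range_sub (fun k => B (T k))] at hs
    have eK : B (T K) = B x := hK _ _ fun j hj => by simp [hTdef, hj]
    have e0 : B (T 0) = B (fun _ => 0) := by rw [show T 0 = fun _ => 0 from stair_zero x (fun _ => 0)]
    rw [eK, e0] at hs; exact hs
  · have hs := sum_le_sum fun k (_ : k ∈ range K) => (hk k).2.2
    rw [sum_range_sub (fun k => B (T' k))] at hs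
    have eK : B (T' K) = B (fun j => x (j + 1)) := hK _ _ fun j hj => by simp [hT'def, hj]
    have e0 : B (T' 0) = B (fun _ => 0) := by rw [show T' 0 = fun _ => 0 from stair_zero (fun j => x (j + 1)) (fun _ => 0)]
    rw [eK, e0] at hs; exact hs


/-! ## §2 «Φ₀√ℓ isotone» for diminishing-returns memory -/

/-- **RATIO BOUND FOR DIMINISHING-RETURNS MEMORY.**  `B` of range `K`, isotone with diminishing returns and coordinatewise concave on the closed box, `B(0) ≥ 0`.
For box configurations `u ≤ v` with `v_j·p′ ≤ u_j·p` at every coordinate (`0 < p′ ≤ p`): `p′·B(v) ≤ p·B(u)`.  PROOF: along the staircase from `u` to `v` the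
increment in coordinate `k` is at most the same increment at the base `u` (diminishing returns), which is at most `(v_k∕u_k − 1)·[B(u) − B(u|_{u_k = 0})]` (chord from
`0`), and the brackets are at most the telescoping shares `B(u_0..u_k, 0, …) − B(u_0..u_{k−1}, 0, …)` (diminishing returns again): `B(v) − B(u) ≤ (p∕p′ − 1)(B(u) − B(0))`.
For separable memory this is `f_k(c)·a ≤ f_k(a)·c` of (E136a) `concave_speed_ratio_le`. [folklore] -/
theorem dr_ratio_le (hK : ∀ u v : ℕ → ℝ, (∀ j, j < K → u j = v j) → B u = B v)
    (hmonoC : ∀ u v : ℕ → ℝ, (∀ j, 0 ≤ u j ∧ u j ≤ γ) → (∀ j, 0 ≤ v j ∧ v j ≤ γ) → (∀ j, u j ≤ v j) → B u ≤ B v)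
    (hDR : ∀ u v : ℕ → ℝ, (∀ j, 0 ≤ u j ∧ u j ≤ γ) → (∀ j, 0 ≤ v j ∧ v j ≤ γ) → (∀ j, u j ≤ v j) → ∀ (k : ℕ) (a c : ℝ), 0 ≤ a → a ≤ c → c ≤ γ →
      B (Function.update v k c) - B (Function.update v k a) ≤ B (Function.update u k c) - B (Function.update u k a))
    (hconc : ∀ u : ℕ → ℝ, (∀ j, 0 ≤ u j ∧ u j ≤ γ) → ∀ (k : ℕ) (a c d e : ℝ), 0 ≤ a → a < c → 0 ≤ d → d < e → a ≤ d → c ≤ e → e ≤ γ →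
      (B (Function.update u k e) - B (Function.update u k d)) * (c - a) ≤ (B (Function.update u k c) - B (Function.update u k a)) * (e - d))
    (hB0 : 0 ≤ B (fun _ => 0))
    {u v : ℕ → ℝ} (hu : SeqBox γ u) (hv : SeqBox γ v) (huv : ∀ j, u j ≤ v j)
    {p p' : ℝ} (hp' : 0 < p') (hp'p : p' ≤ p) (hr : ∀ j, v j * p' ≤ u j * p) : p' * B v ≤ p * B u := by
  have hγ : 0 ≤ γ := (hu 0).1.le.trans (hu 0).2
  have huC := cbox_of_seqBox hu
  have hvC := cbox_of_seqBox hv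
  have h0C : ∀ j : ℕ, 0 ≤ (fun _ : ℕ => (0:ℝ)) j ∧ (fun _ : ℕ => (0:ℝ)) j ≤ γ := fun _ => ⟨le_rfl, hγ⟩
  set Z : ℕ → ℕ → ℝ := fun k j => if j < k then v j else u j with hZdef
  set U : ℕ → ℕ → ℝ := fun k j => if j < k then u j else 0 with hUdef
  have hZC : ∀ k, ∀ j, 0 ≤ Z k j ∧ Z k j ≤ γ := fun k => cbox_stair hvC huC k
  have hUC : ∀ k, ∀ j, 0 ≤ U k j ∧ U k j ≤ γ := fun k => cbox_stair huC h0C k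
  have hZs : ∀ k, Z (k + 1) = Function.update (Z k) k (v k) := fun k => stair_succ v u k
  have hZe : ∀ k, Z k = Function.update (Z k) k (u k) := fun k => stair_eq_update v u k
  have hUs : ∀ k, U (k + 1) = Function.update (U k) k (u k) := fun k => stair_succ u (fun _ => 0) k
  have hUe : ∀ k, U k = Function.update (U k) k 0 := fun k => stair_eq_update u (fun _ => 0) k
  -- per coordinate: p′·(B(Z_{k+1}) − B(Z_k)) ≤ (p − p′)·(B(U_{k+1}) − B(U_k))
  have hk : ∀ k, p' * (B (Z (k + 1)) - B (Z k)) ≤ (p - p') * (B (U (k + 1)) - B (U k)) := by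
    intro k
    have huk : 0 < u k := (hu k).1
    have hvk : 0 < v k := (hv k).1
    have hukγ : u k ≤ γ := (hu k).2
    have hvkγ : v k ≤ γ := (hv k).2
    have hle : u k ≤ v k := huv k
    -- DR: the staircase increment is at most the increment at the base u
    have h1 := hDR u (Z k) huC (hZC k) (fun j => by
        show u j ≤ (if j < k then v j else u j)
        by_cases hj : j < k
        · simp [hj, huv j]
        · simp [hj]) k (u k) (v k) huk.le hle hvkγ
    rw [← hZs k, ← hZe k, Function.update_eq_self] at h1
    -- the share: B(u) − B(u|0) ≤ B(U_{k+1}) − B(U_k)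
    have h2 := hDR (U k) u (hUC k) huC (fun j => by
        show (if j < k then u j else (0:ℝ)) ≤ u j
        by_cases hj : j < k
        · simp [hj]
        · simp [hj, (hu j).1.le]) k 0 (u k) le_rfl huk.le hukγ
    rw [Function.update_eq_self, ← hUs k, ← hUe k] at h2
    have hsh0 : 0 ≤ B u - B (Function.update u k 0) := by
      refine sub_nonneg.mpr (hmonoC _ _ (cbox_update huC le_rfl hγ k) huC fun j => ?_)
      rcases eq_or_ne j k with rfl | hjk
      · simp [huk.le]
      · rw [Function.update_of_ne hjk]
    -- chord from 0: (B(u|v_k) − B(u))·u_k ≤ (B(u) − B(u|0))·(v_k − u_k)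
    have h3 : (B (Function.update u k (v k)) - B u) * u k ≤ (B u - B (Function.update u k 0)) * (v k - u k) := by
      rcases hle.eq_or_lt with heq | hlt
      · rw [← heq, Function.update_eq_self]; simp
      · have := hconc u huC k 0 (u k) (u k) (v k) le_rfl huk huk.le hlt huk.le hlt.le hvkγ
        rw [Function.update_eq_self, sub_zero] at this
        exact this
    -- ratio: (v_k − u_k)·p′ ≤ u_k·(p − p′)
    have h4 : (v k - u k) * p' ≤ u k * (p - p') := by nlinarith [hr k]
    -- combine and divide by u_k
    have h5 : p' * (B (Function.update u k (v k)) - B u) * u k ≤ (p - p') * (B u - B (Function.update u k 0)) * u k := by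
      nlinarith [mul_le_mul_of_nonneg_left h4 hsh0, mul_le_mul_of_nonneg_left h3 hp'.le]
    have h6 : p' * (B (Function.update u k (v k)) - B u) ≤ (p - p') * (B u - B (Function.update u k 0)) := le_of_mul_le_mul_right h5 huk
    have hpp : 0 ≤ p - p' := by linarith
    nlinarith [mul_le_mul_of_nonneg_left h1 hp'.le, mul_le_mul_of_nonneg_left h2 hpp]
  have hs := sum_le_sum fun k (_ : k ∈ range K) => hk k
  rw [← mul_sum, ← mul_sum, sum_range_sub (fun k => B (Z k)), sum_range_sub (fun k => B (U k))] at hs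
  have eZK : B (Z K) = B v := hK _ _ fun j hj => by simp [hZdef, hj]
  have eZ0 : B (Z 0) = B u := by rw [show Z 0 = u from stair_zero v u]
  have eUK : B (U K) = B u := hK _ _ fun j hj => by simp [hUdef, hj]
  have eU0 : B (U 0) = B (fun _ => 0) := by rw [show U 0 = fun _ => 0 from stair_zero u (fun _ => 0)]
  rw [eZK, eZ0, eUK, eU0] at hs
  have hpp : 0 ≤ p - p' := by linarith
  nlinarith [mul_nonneg hpp hB0]

/-- **«Φ₀√ℓ ISOTONE» FOR DIMINISHING-RETURNS MEMORY**: with unique box solutions `S p` of the isotone base (floor, modulus), for pins `0 < p′ ≤ p ≤ γ`,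
`p′·B(tail_1 S p) ≤ p·B(tail_1 S p′)` — `dr_ratio_le` on the tails, which are ordered (`le_of_pin_le`) with coordinate ratios at most `p∕p′` ((E132) `scale_ratio_le`).
The affine and separable-concave statements are (E132) `affine_speed_ratio_le`, (E136a) `concave_speed_ratio_le`. [folklore] -/
theorem dr_speed_ratio_le (hK : ∀ u v : ℕ → ℝ, (∀ j, j < K → u j = v j) → B u = B v)
    (hmonoC : ∀ u v : ℕ → ℝ, (∀ j, 0 ≤ u j ∧ u j ≤ γ) → (∀ j, 0 ≤ v j ∧ v j ≤ γ) → (∀ j, u j ≤ v j) → B u ≤ B v)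
    (hDR : ∀ u v : ℕ → ℝ, (∀ j, 0 ≤ u j ∧ u j ≤ γ) → (∀ j, 0 ≤ v j ∧ v j ≤ γ) → (∀ j, u j ≤ v j) → ∀ (k : ℕ) (a c : ℝ), 0 ≤ a → a ≤ c → c ≤ γ →
      B (Function.update v k c) - B (Function.update v k a) ≤ B (Function.update u k c) - B (Function.update u k a))
    (hconc : ∀ u : ℕ → ℝ, (∀ j, 0 ≤ u j ∧ u j ≤ γ) → ∀ (k : ℕ) (a c d e : ℝ), 0 ≤ a → a < c → 0 ≤ d → d < e → a ≤ d → c ≤ e → e ≤ γ →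
      (B (Function.update u k e) - B (Function.update u k d)) * (c - a) ≤ (B (Function.update u k c) - B (Function.update u k a)) * (e - d))
    (hB0 : 0 ≤ B (fun _ => 0))
    (hb : 0 < b)
    (hmono : ∀ u v : ℕ → ℝ, SeqBox γ u → SeqBox γ v → (∀ i, u i ≤ v i) → B u ≤ B v)
    (hB : ∀ u u' : ℕ → ℝ, SeqBox γ u → SeqBox γ u' → ∀ D : ℝ, (∀ j, |u j - u' j| ≤ D) → |B u - B u'| ≤ M * D) (hM : 0 ≤ M)
    (hlo : ∀ u, SeqBox γ u → b ≤ B u)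
    (hS : ∀ p, 0 < p → p ≤ γ → SeqBox γ (S p) ∧ MemFlow B p (S p))
    (huniq : ∀ p, 0 < p → p ≤ γ → ∀ u u' : ℕ → ℝ, SeqBox γ u → SeqBox γ u' → MemFlow B p u → MemFlow B p u' → u = u')
    {p p' : ℝ} (hp' : 0 < p') (hp'p : p' ≤ p) (hpγ : p ≤ γ) :
    p' * B (fun i => S p (1 + i)) ≤ p * B (fun i => S p' (1 + i)) := by
  have hp : 0 < p := hp'.trans_le hp'p
  have hp'γ : p' ≤ γ := hp'p.trans hpγ
  have hb1 : SeqBox γ (fun i => S p (1 + i)) := fun i => (hS p hp hpγ).1 (1 + i)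
  have hb2 : SeqBox γ (fun i => S p' (1 + i)) := fun i => (hS p' hp' hp'γ).1 (1 + i)
  have hle : ∀ i, S p' (1 + i) ≤ S p (1 + i) := fun i =>
    le_of_pin_le hb hB hM hlo huniq hp' hp'p hpγ (hS p' hp' hp'γ).1 (hS p hp hpγ).1 (hS p' hp' hp'γ).2 (hS p hp hpγ).2 (1 + i)
  have hr : ∀ i, S p (1 + i) * p' ≤ S p' (1 + i) * p := fun i => scale_ratio_le hb hmono hB hM hlo hS huniq hp' hp'p hpγ (1 + i)
  exact dr_ratio_le hK hmonoC hDR hconc hB0 hb2 hb1 hle hp' hp'p hr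

/-! ## §3 The deficit of one age -/

/-- **THE DEFICIT OF ONE AGE (diminishing-returns memory).**  As (E133) `dual_deficit_le` ∕ (E136a) `concave_deficit_le`, with `dr_speed_ratio_le` supplying the
perturbed step `≥ (w∕x)Φ⁰`: `((S h′_j)_k − (S h′_j)_{k+1}) − (h′_{j+k} − h′_{j+k+1}) ≤ x³Φ⁰·w²δ`. [folklore] -/
theorem dr_deficit_le {B' : (ℕ → ℝ) → ℝ} (hK : ∀ u v : ℕ → ℝ, (∀ j, j < K → u j = v j) → B u = B v)
    (hmonoC : ∀ u v : ℕ → ℝ, (∀ j, 0 ≤ u j ∧ u j ≤ γ) → (∀ j, 0 ≤ v j ∧ v j ≤ γ) → (∀ j, u j ≤ v j) → B u ≤ B v)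
    (hDR : ∀ u v : ℕ → ℝ, (∀ j, 0 ≤ u j ∧ u j ≤ γ) → (∀ j, 0 ≤ v j ∧ v j ≤ γ) → (∀ j, u j ≤ v j) → ∀ (k : ℕ) (a c : ℝ), 0 ≤ a → a ≤ c → c ≤ γ →
      B (Function.update v k c) - B (Function.update v k a) ≤ B (Function.update u k c) - B (Function.update u k a))
    (hconc : ∀ u : ℕ → ℝ, (∀ j, 0 ≤ u j ∧ u j ≤ γ) → ∀ (k : ℕ) (a c d e : ℝ), 0 ≤ a → a < c → 0 ≤ d → d < e → a ≤ d → c ≤ e → e ≤ γ →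
      (B (Function.update u k e) - B (Function.update u k d)) * (c - a) ≤ (B (Function.update u k c) - B (Function.update u k a)) * (e - d))
    (hB0 : 0 ≤ B (fun _ => 0))
    (hb : 0 < b)
    (hmono : ∀ u v : ℕ → ℝ, SeqBox γ u → SeqBox γ v → (∀ i, u i ≤ v i) → B u ≤ B v)
    (hB : ∀ u u' : ℕ → ℝ, SeqBox γ u → SeqBox γ u' → ∀ D : ℝ, (∀ j, |u j - u' j| ≤ D) → |B u - B u'| ≤ M * D) (hM : 0 ≤ M)
    (hlo : ∀ u, SeqBox γ u → b ≤ B u)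
    (hS : ∀ p, 0 < p → p ≤ γ → SeqBox γ (S p) ∧ MemFlow B p (S p))
    (huniq : ∀ p, 0 < p → p ≤ γ → ∀ u u' : ℕ → ℝ, SeqBox γ u → SeqBox γ u' → MemFlow B p u → MemFlow B p u' → u = u')
    (hh' : SeqBox γ h') {y : ℝ} (hf' : MemFlow B' y h') (j k : ℕ) (hcmp : h' (j + k) ≤ S (h' j) k)
    (hX : B (fun i => S (h' (j + k)) (1 + i)) ≤ B' (fun i => h' (j + k + 1 + i))) :
    (S (h' j) k - S (h' j) (k + 1)) - (h' (j + k) - h' (j + k + 1))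
      ≤ S (h' j) k ^ 3 * (1 / S (h' j) (k + 1) ^ 2 - 1 / S (h' j) k ^ 2) * (h' (j + k) ^ 2 * (1 / h' (j + k) ^ 2 - 1 / S (h' j) k ^ 2)) := by
  have hpj := hh' j
  have hSj := hS (h' j) hpj.1 hpj.2
  have hx := family_mem hS hpj.1 hpj.2 k
  have hw0 : 0 < h' (j + k) := (hh' (j + k)).1
  have hxp : 0 < S (h' j) (k + 1) := (hSj.1 (k + 1)).1
  have hwp : 0 < h' (j + k + 1) := (hh' (j + k + 1)).1
  have hx_lev : 1 / S (h' j) (k + 1) ^ 2 = 1 / S (h' j) k ^ 2 + B (fun i => S (h' j) (k + 1 + i)) := hSj.2.2 k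
  have htail : (fun i => S (h' j) (k + 1 + i)) = (fun i => S (S (h' j) k) (1 + i)) := by
    funext i
    have := congrFun (family_tail_eq hS huniq hpj.1 hpj.2 k) (1 + i)
    simpa [Nat.add_assoc] using this
  have hΦ0 : 0 ≤ B (fun i => S (h' j) (k + 1 + i)) := hb.le.trans (hlo _ (fun i => hSj.1 (k + 1 + i)))
  have hw_lev : 1 / h' (j + k) ^ 2 + h' (j + k) / S (h' j) k * B (fun i => S (h' j) (k + 1 + i)) ≤ 1 / h' (j + k + 1) ^ 2 := by
    have hstep : 1 / h' (j + k + 1) ^ 2 = 1 / h' (j + k) ^ 2 + B' (fun i => h' (j + k + 1 + i)) := hf'.2 (j + k)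
    have hratio := dr_speed_ratio_le hK hmonoC hDR hconc hB0 hb hmono hB hM hlo hS huniq hw0 hcmp hx.2
    rw [htail, hstep]
    have hxpos : 0 < S (h' j) k := hx.1
    have h1 : h' (j + k) / S (h' j) k * B (fun i => S (S (h' j) k) (1 + i)) ≤ B (fun i => S (h' (j + k)) (1 + i)) := by
      rw [div_mul_eq_mul_div, div_le_iff₀ hxpos]
      linarith [hratio]
    linarith [h1, hX]
  have h := deficit_le_gap hw0 hcmp hΦ0 hxp hwp hx_lev hw_lev
  have e : B (fun i => S (h' j) (k + 1 + i)) = 1 / S (h' j) (k + 1) ^ 2 - 1 / S (h' j) k ^ 2 := by rw [hx_lev]; ring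
  rw [e] at h
  exact h

end Summit.QuantumFields.BalabanUV.Beta.EriceRemainderEnclosureHistoryAutonomyComparisonDualDiminishingShares

end
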